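import Mathlib
import HarnessLib

/-!
# Crux `EfficiencyFloor.ProductionEfficiencyDecay` (stmt-NavierStokesRegularity-22866): in the class of enstrophy curves allowed by
# the landed information, the POINTWISE crux is STRICTLY stronger than its MEAN form — an explicit oscillating curve

Helper file (`--supports stmt-NavierStokesRegularity-22866`), companion of `…ProductionEfficiencyDecayMeanForm` (p825059: the
route's assembly consumes only the MEAN form `Z(s)⁻² ≤ ε(T−s)` of the crux). Everything the tree knows about the enstrophy
`Z` of a hypothetical first blow-up at the level of ONE real function is: positivity, the Lu–Doering cubic law `Ż ≤ K·Z³`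
(stmt-22995/25481), divergence `Z → ∞` (stmt-22867), and — if the crux holds — the efficiency law. This file exhibits ONE
real curve on `[0,1)` with all of: `Z > 0`, `Ż ≤ 4Z³`, `Z → ∞`, the MEAN law for every `ε` (`Z(s)⁻² ≤ ε(1−s)` late), and yet
NOT the pointwise law (`Ż ≥ Z³/8` at the times `1 − t = 1/(2πn)`):

  `Z(t) = (2 + sin((1−t)⁻¹))·(1−t)⁻¹`,  `Ż(t) = cos((1−t)⁻¹)·(1−t)⁻³ + (2 + sin((1−t)⁻¹))·(1−t)⁻²`.

So no argument using only these scalar facts can upgrade the mean form to the filed pointwise crux: the extra content of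
stmt-22866 over what `closes` needs is the exclusion of late enstrophy OSCILLATIONS at frequency `∼(T−t)⁻²` (allowed by the
cubic law), a Navier–Stokes-specific statement no mechanism of the line addresses. HONEST FRAMING: a statement about one
explicit real function; nothing about Navier–Stokes; stmt-22866 and Navier–Stokes regularity stay OPEN. [folklore]
-/

-- the problem directory repeats the summit name (`NavierStokesRegularity/NavierStokesRegularity`)
set_option linter.dupNamespace false

noncomputable section

namespace Summit.NavierStokesRegularity.NavierStokesRegularity.Theorems

namespace ProductionEfficiencyDecay

namespace MeanForm

open Set Filter Topology Real

/-- Derivative of the model curve `t ↦ (2 + sin((1−t)⁻¹))·(1−t)⁻¹` at `t < 1`. [folklore] -/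
theorem hasDerivAt_oscillating {t : ℝ} (ht : t < 1) :
    HasDerivAt (fun t : ℝ => (2 + Real.sin ((1 - t)⁻¹)) * (1 - t)⁻¹)
      (Real.cos ((1 - t)⁻¹) * (1 - t)⁻¹ ^ 3 + (2 + Real.sin ((1 - t)⁻¹)) * (1 - t)⁻¹ ^ 2) t := by
  have hτ : (1 - t) ≠ 0 := (sub_pos.2 ht).ne'
  have hg : HasDerivAt (fun t : ℝ => (1 - t)⁻¹) ((1 - t)⁻¹ ^ 2) t := by
    have h1 : HasDerivAt (fun t : ℝ => 1 - t) (-1) t := by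
      simpa using (hasDerivAt_id t).const_sub 1
    have h2 := h1.inv hτ
    refine h2.congr_deriv ?_
    field_simp
  have hsin : HasDerivAt (fun t : ℝ => Real.sin ((1 - t)⁻¹)) (Real.cos ((1 - t)⁻¹) * (1 - t)⁻¹ ^ 2) t :=
    (Real.hasDerivAt_sin _).comp t hg
  have h := (hsin.const_add 2).mul hg
  refine h.congr_deriv ?_
  ring

/-- **The oscillating curve**: positive, obeys the cubic law `Ż ≤ 4Z³`, diverges at `1`, satisfies the MEAN efficiency law for
every `ε`, and violates the POINTWISE law `Ż ≤ εZ³` (for `ε = 1/16`) at times accumulating at `1`. [folklore] -/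
theorem oscillating_example :
    ∃ Z D : ℝ → ℝ,
      (∀ t ∈ Set.Ico (0 : ℝ) 1, 0 < Z t ∧ HasDerivAt Z (D t) t ∧ D t ≤ 4 * Z t ^ 3) ∧
      (∀ N : ℝ, ∃ t₁ ∈ Set.Ico (0 : ℝ) 1, ∀ t ∈ Set.Ico t₁ 1, N ≤ Z t) ∧
      (∀ ε : ℝ, 0 < ε → ∃ t₁ ∈ Set.Ico (0 : ℝ) 1, ∀ s ∈ Set.Ico t₁ 1, (Z s)⁻¹ ^ 2 ≤ ε * (1 - s)) ∧
      ¬ (∀ ε : ℝ, 0 < ε → ∃ t₁ ∈ Set.Ico (0 : ℝ) 1, ∀ t ∈ Set.Ico t₁ 1, D t ≤ ε * Z t ^ 3) := by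
  refine ⟨fun t => (2 + Real.sin ((1 - t)⁻¹)) * (1 - t)⁻¹,
    fun t => Real.cos ((1 - t)⁻¹) * (1 - t)⁻¹ ^ 3 + (2 + Real.sin ((1 - t)⁻¹)) * (1 - t)⁻¹ ^ 2,
    ?_, ?_, ?_, ?_⟩
  · -- positivity, derivative, cubic law
    intro t ht
    have hτ : 0 < 1 - t := by linarith [ht.2]
    set x : ℝ := (1 - t)⁻¹ with hx
    have hx1 : 1 ≤ x := by
      rw [hx]; exact (one_le_inv₀ hτ).2 (by linarith [ht.1])
    have hx0 : 0 < x := by linarith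
    set σ : ℝ := Real.sin x with hσ
    set κ : ℝ := Real.cos x with hκ
    have hσ1 : -1 ≤ σ := Real.neg_one_le_sin x
    have hσ2 : σ ≤ 1 := Real.sin_le_one x
    have hκ1 : κ ≤ 1 := Real.cos_le_one x
    have h2σ : 1 ≤ 2 + σ := by linarith
    refine ⟨by positivity, hasDerivAt_oscillating ht.2, ?_⟩
    -- `κ x³ + (2+σ) x² ≤ x³ + 3x³ = 4x³ ≤ 4 ((2+σ) x)³`
    have h1 : κ * x ^ 3 ≤ x ^ 3 := by nlinarith [pow_pos hx0 3]
    have h2 : (2 + σ) * x ^ 2 ≤ 3 * x ^ 3 := by nlinarith [pow_pos hx0 2]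
    have h3 : x ^ 3 ≤ ((2 + σ) * x) ^ 3 := by
      have : x ≤ (2 + σ) * x := by nlinarith
      exact pow_le_pow_left₀ hx0.le this 3
    nlinarith
  · -- divergence
    intro N
    refine ⟨max 0 (1 - 1 / max N 1), ⟨le_max_left _ _, ?_⟩, fun t ht => ?_⟩
    · have : 0 < 1 / max N 1 := by positivity
      exact max_lt one_pos (by linarith)
    have hτ : 0 < 1 - t := by linarith [ht.2]
    have hM : 0 < max N 1 := by positivity
    have hτle : 1 - t ≤ 1 / max N 1 := by linarith [le_max_right 0 (1 - 1 / max N 1), ht.1]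
    have hx : max N 1 ≤ (1 - t)⁻¹ := by
      rw [le_inv_comm₀ hM hτ, ← one_div]; exact hτle
    have h2σ : 1 ≤ 2 + Real.sin ((1 - t)⁻¹) := by linarith [Real.neg_one_le_sin ((1 - t)⁻¹)]
    calc N ≤ max N 1 := le_max_left _ _
      _ ≤ (1 - t)⁻¹ := hx
      _ ≤ (2 + Real.sin ((1 - t)⁻¹)) * (1 - t)⁻¹ := le_mul_of_one_le_left (inv_nonneg.2 hτ.le) h2σ
  · -- mean law
    intro ε hε
    refine ⟨max 0 (1 - ε), ⟨le_max_left _ _, max_lt one_pos (by linarith)⟩, fun s hs => ?_⟩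
    have hτ : 0 < 1 - s := by linarith [hs.2]
    have hτε : 1 - s ≤ ε := by linarith [le_max_right 0 (1 - ε), hs.1]
    have h2σ : 1 ≤ 2 + Real.sin ((1 - s)⁻¹) := by linarith [Real.neg_one_le_sin ((1 - s)⁻¹)]
    have hZge : (1 - s)⁻¹ ≤ (2 + Real.sin ((1 - s)⁻¹)) * (1 - s)⁻¹ :=
      le_mul_of_one_le_left (inv_nonneg.2 hτ.le) h2σ
    have hxpos : 0 < (1 - s)⁻¹ := inv_pos.2 hτ
    have hinv : ((2 + Real.sin ((1 - s)⁻¹)) * (1 - s)⁻¹)⁻¹ ≤ 1 - s := by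
      calc ((2 + Real.sin ((1 - s)⁻¹)) * (1 - s)⁻¹)⁻¹ ≤ ((1 - s)⁻¹)⁻¹ := (inv_le_inv₀ (hxpos.trans_le hZge) hxpos).2 hZge
        _ = 1 - s := inv_inv _
    have hinv0 : 0 ≤ ((2 + Real.sin ((1 - s)⁻¹)) * (1 - s)⁻¹)⁻¹ := inv_nonneg.2 (hxpos.trans_le hZge).le
    calc ((2 + Real.sin ((1 - s)⁻¹)) * (1 - s)⁻¹)⁻¹ ^ 2 ≤ (1 - s) ^ 2 := pow_le_pow_left₀ hinv0 hinv 2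
      _ = (1 - s) * (1 - s) := sq _
      _ ≤ ε * (1 - s) := mul_le_mul_of_nonneg_right hτε hτ.le
  · -- the pointwise law fails at `1 - t = 1/(2πn)`
    intro h
    obtain ⟨t₁, ht₁, hlaw⟩ := h (1 / 16) (by norm_num)
    have hτ₁ : 0 < 1 - t₁ := by linarith [ht₁.2]
    obtain ⟨n, hn⟩ := exists_nat_ge (max 1 (1 / (2 * π * (1 - t₁))))
    have hn1 : (1 : ℝ) ≤ n := (le_max_left _ _).trans hn
    have hn0 : (0 : ℝ) < n := by linarith
    set τ : ℝ := 1 / (n * (2 * π)) with hτdef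
    have hτpos : 0 < τ := by rw [hτdef]; positivity
    have hτle : τ ≤ 1 - t₁ := by
      have h1 : 1 / (2 * π * (1 - t₁)) ≤ n := (le_max_right _ _).trans hn
      rw [hτdef, div_le_iff₀ (by positivity)]
      rw [div_le_iff₀ (by positivity)] at h1
      nlinarith [h1, Real.pi_pos]
    set t : ℝ := 1 - τ with htdef
    have htI : t ∈ Set.Ico t₁ 1 := ⟨by rw [htdef]; linarith, by rw [htdef]; linarith⟩
    have hD := hlaw t htI
    have h1t : 1 - t = τ := by rw [htdef]; ring
    have hinv : (1 - t)⁻¹ = n * (2 * π) := by rw [h1t, hτdef, one_div, inv_inv]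
    have hsin : Real.sin ((1 - t)⁻¹) = 0 := by
      rw [hinv, show (n : ℝ) * (2 * π) = ((2 * n : ℕ) : ℝ) * π by push_cast; ring]
      exact Real.sin_nat_mul_pi _
    have hcos : Real.cos ((1 - t)⁻¹) = 1 := by
      rw [hinv]; exact Real.cos_nat_mul_two_pi n
    simp only [hsin, hcos, add_zero, one_mul] at hD
    -- hD : x³ + 2 x² ≤ 1/16 * (2 x)³ with x = (1-t)⁻¹ > 0
    have hx : 0 < (1 - t)⁻¹ := by rw [hinv]; positivity
    nlinarith [pow_pos hx 3, pow_pos hx 2]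

end MeanForm

end ProductionEfficiencyDecay

end Summit.NavierStokesRegularity.NavierStokesRegularity.Theorems

end
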